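import Mathlib
import HarnessLib
import Summits.KontsevichZagierPeriods.KontsevichZagierPeriods.Theses.FurushoPentagon
import Summits.KontsevichZagierPeriods.KontsevichZagierPeriods.Theorems.FurushoPentagonKernelModuloPeriodConjectureFormalHoffmanSpan
import Summits.KontsevichZagierPeriods.KontsevichZagierPeriods.Theorems.FurushoPentagonKernelModuloPeriodConjectureSectorKernelOfFormalSpan
import Literature.NumberTheory.Transcendental.KZRulesAssociator

/-!
# `ReducedPeriodRing` (stmt-KontsevichZagierPeriods-3929) is not load-bearing for the remainder's MZV-sector transfer, given the ideal-level leaf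

Negative knowledge on the LOAD-BEARING STATUS of the crux `FurushoPentagon.ReducedPeriodRing`
(stmt-KontsevichZagierPeriods-3929; companion of `Negative/LoadBearing.lean`,
`Negative/LineLoadBearing.lean`), a kernel-checked D-0014 note of lead c9 for the route planner,
concerning the declared remainder `FurushoPentagon.KernelModuloPeriodConjecture`
(stmt-KontsevichZagierPeriods-15058), the only place where `closes` consumes `hR`.

The landed MZV-sector transfer `mzvSectorKernel_of` (`…MzvSectorTransfer.lean`) reads
`PentagonInKZ → ReducedPeriodRing → AssociatorHoffmanSpanning → MzvPeriodConjecture →`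
Conjecture 1 on the MZV sector, where the algebraic leaf `AssociatorHoffmanSpanning` is quantified
over REDUCED commutative `ℚ`-algebras and `ReducedPeriodRing` serves exactly once: to make
`P_ℚ = ℚ ⊗ (FormalRep ⧸ relations)` an admissible (reduced) test algebra
(`stub_formalHoffmanSpan`, `isReduced_formalPeriodAlgebra hR`). This file records that with the
leaf stated IDEAL-THEORETICALLY — the same Hoffman-spanning identity at every group-like pentagon
solution over EVERY commutative `ℚ`-algebra (i.e. in the coordinate ring of the affine scheme
`GroupLike ∩ Pent` itself rather than in its reduction) — the crux `ReducedPeriodRing` drops out: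

* `formalHoffmanSpan_of_idealLeaf` — `PentagonInKZ →` ideal-level leaf `→` formal Hoffman
  spanning in `P_ℚ` (the proof of `stub_formalHoffmanSpan` verbatim, minus the `IsReduced`
  instance);
* `mzvSectorKernel_of_idealLeaf` — `PentagonInKZ →` ideal-level leaf `→ MzvPeriodConjecture →`
  Conjecture 1 in kernel form on the subgroup generated by the simplex classes
  (composition with the landed `stub_sectorKernelOfFormalSpan`);
  (`PentagonInKZ` itself is a theorem of the tree, `PentagonInKZ_of` in
  `Theorems/FurushoPentagonPentagonInKZ.lean`; it is kept as a hypothesis here only because that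
  module and `KZRulesAssociator`'s import closure currently cannot be imported together —
  duplicate auxiliary declaration `NCSeries.push_ofFn.match_1_1` in
  `AssociatorsDefectSeriesProofs` / `DrinfeldAssociatorToolkit`);
* `reducedLeaf_of_idealLeaf` — the ideal-level leaf trivially implies the reduced-level one.

The two leaves differ exactly by the nilradical of the coordinate ring of `GroupLike ∩ Pent` in
the relevant weights; they coincide if that affine `ℚ`-scheme is reduced (plausible — over `μ ≠ 0`
it is a quotient of Drinfeld's smooth `GRT₁`-torsor of associators — but not proved here or, to our
knowledge, in print as a scheme statement). Both leaves are conjecture-grade (coordinate form of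
`GRT₁ ≅ U^{dR}_{MT(ℤ)}` together with Brown's theorem). Nothing is claimed about either; the point
recorded is structural: on the MZV sector the remainder needs reducedness of `P` only through the
choice of leaf (the weight-by-weight leaf tables being landed on item 15058, `stub_leafTable8C` …, are already ideal-level identities: no `IsReduced` binder). No definitions, no named facts. `--supports stmt-KontsevichZagierPeriods-3929`.

References: H. Furusho, Ann. of Math. 174 (2011), §2 [Furusho2011]; V. Drinfeld, Leningrad Math.
J. 2 (1991), §5 [Drinfeld1991]; F. Brown, Ann. of Math. 175 (2012), Thm 1.1 [Brown2012];
M. Kontsevich, D. Zagier, *Periods* (2001), §1.2, §4.1 [KontsevichZagier2001].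
-/

noncomputable section

namespace Summit.KontsevichZagierPeriods.FurushoPentagon.KernelModuloPeriodConjecture

open Literature.NumberTheory.Transcendental
open Literature.NumberTheory.Transcendental.KZ
open Summit.KontsevichZagierPeriods.KontsevichZagierPeriods.Theses.FurushoPentagon
open Summit.KontsevichZagierPeriods.FurushoPentagon.PentagonInKZNegative
  (pentagonInKZ_iff_rulesAssociator)

/-- The ideal-level algebraic leaf implies the reduced-level leaf of `mzvSectorKernel_of`
(restriction of the test algebras). [folklore] -/
theorem reducedLeaf_of_idealLeaf
    (hA : ∀ s : List ℕ, MZV.IsAdmissible s → ∃ b : List ℕ →₀ ℚ, (∀ t ∈ b.support, MZV.IsHoffman t ∧ MZV.weight t = MZV.weight s) ∧ ∀ (R : Type) [CommRing R] [Algebra ℚ R] (φ : NCSeries Bool R), NCSeries.IsGroupLike φ → NCSeries.DrinfeldPentagon φ → φ (MZV.binaryWord s) = b.sum (fun t q => q • φ (MZV.binaryWord t))) :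
    ∀ s : List ℕ, MZV.IsAdmissible s → ∃ b : List ℕ →₀ ℚ, (∀ t ∈ b.support, MZV.IsHoffman t ∧ MZV.weight t = MZV.weight s) ∧ ∀ (R : Type) [CommRing R] [Algebra ℚ R] [IsReduced R] (φ : NCSeries Bool R), NCSeries.IsGroupLike φ → NCSeries.DrinfeldPentagon φ → φ (MZV.binaryWord s) = b.sum (fun t q => q • φ (MZV.binaryWord t)) := by
  intro s hs
  obtain ⟨b, hb, hall⟩ := hA s hs
  exact ⟨b, hb, fun R _ _ _ φ hφ hP => hall R φ hφ hP⟩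

/-- **Formal Hoffman spanning in `P_ℚ` from the ideal-level leaf, without `ReducedPeriodRing`.**
Under `PentagonInKZ`, reading the ideal-level leaf at the group-like pentagon point `Φ_P` over the
(possibly non-reduced) `ℚ`-algebra `P_ℚ` gives, for every admissible `s`,
`1 ⊗ ⟦ζ(s)⟧ ∈ span_ℚ {1 ⊗ ⟦ζ(t)⟧ : t Hoffman}` — the conclusion of `stub_formalHoffmanSpan`, same
proof minus the `IsReduced P_ℚ` instance. [cite: Furusho2011, §2] -/
theorem formalHoffmanSpan_of_idealLeaf (hP : PentagonInKZ)
    (hA : ∀ s : List ℕ, MZV.IsAdmissible s → ∃ b : List ℕ →₀ ℚ, (∀ t ∈ b.support, MZV.IsHoffman t ∧ MZV.weight t = MZV.weight s) ∧ ∀ (R : Type) [CommRing R] [Algebra ℚ R] (φ : NCSeries Bool R), NCSeries.IsGroupLike φ → NCSeries.DrinfeldPentagon φ → φ (MZV.binaryWord s) = b.sum (fun t q => q • φ (MZV.binaryWord t))) :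
    ∀ s : List ℕ, MZV.IsAdmissible s → KZ.toPeriodAlgebra (KZ.mzvClass s) ∈ Submodule.span ℚ (Set.range (fun t : {t : List ℕ // MZV.IsHoffman t} => KZ.toPeriodAlgebra (KZ.mzvClass t.1))) := by
  intro s hs
  have hPent : NCSeries.DrinfeldPentagon KZ.rulesAssociator := pentagonInKZ_iff_rulesAssociator.mp hP
  obtain ⟨b, hb, hall⟩ := hA s hs
  have key := hall KZ.FormalPeriodAlgebra KZ.rulesAssociator isGroupLike_rulesAssociator hPent
  rw [KZ.rulesAssociator_binaryWord hs] at key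
  have hx : KZ.toPeriodAlgebra (KZ.mzvClass s) =
      (-1 : KZ.FormalPeriodAlgebra) ^ MZV.depth s *
        b.sum (fun t q => q • KZ.rulesAssociator (MZV.binaryWord t)) := by
    rw [← key, ← mul_assoc, ← pow_add, ← two_mul, pow_mul, neg_one_sq, one_pow, one_mul]
  rw [hx, formalSpan_neg_one_pow_mul]
  refine Submodule.smul_mem _ _ ?_
  rw [Finsupp.sum]
  refine Submodule.sum_mem _ fun t ht => ?_
  have hH : MZV.IsHoffman t := (hb t ht).1
  rw [KZ.rulesAssociator_binaryWord hH.isAdmissible, formalSpan_neg_one_pow_mul]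
  refine Submodule.smul_mem _ _ (Submodule.smul_mem _ _ (Submodule.subset_span ?_))
  exact ⟨⟨t, hH⟩, rfl⟩

/-- **The MZV-sector transfer without `ReducedPeriodRing`.** `PentagonInKZ →` ideal-level leaf
`→ MzvPeriodConjecture →` Conjecture 1 in kernel form on the subgroup of `KZ.FormalRep` generated
by the simplex classes of the multiple zeta values (composition with the landed
`stub_sectorKernelOfFormalSpan`). Compare `mzvSectorKernel_of`, which takes the reduced-level leaf
and `ReducedPeriodRing`. [cite: Furusho2011, §2] -/
theorem mzvSectorKernel_of_idealLeaf (hP : PentagonInKZ)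
    (hA : ∀ s : List ℕ, MZV.IsAdmissible s → ∃ b : List ℕ →₀ ℚ, (∀ t ∈ b.support, MZV.IsHoffman t ∧ MZV.weight t = MZV.weight s) ∧ ∀ (R : Type) [CommRing R] [Algebra ℚ R] (φ : NCSeries Bool R), NCSeries.IsGroupLike φ → NCSeries.DrinfeldPentagon φ → φ (MZV.binaryWord s) = b.sum (fun t q => q • φ (MZV.binaryWord t)))
    (hZ : MzvPeriodConjecture) :
    ∀ c ∈ AddSubgroup.closure (Set.range (fun s : {s : List ℕ // MZV.IsAdmissible s} => KZ.of (KZ.mzvRep s.1 s.2 (KZ.mzvIntegrand_isSemialgebraicFunOn_holds s.1) (KZ.mzvIntegrand_integrableOn_holds s.1 s.2)))), KZ.eval c = 0 → c ∈ KZ.relations :=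
  stub_sectorKernelOfFormalSpan (formalHoffmanSpan_of_idealLeaf hP hA) hZ

end Summit.KontsevichZagierPeriods.FurushoPentagon.KernelModuloPeriodConjecture

end
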